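import Literature.AlgebraicGeometry.Modules.SheafHomFunctor
import Literature.AlgebraicGeometry.Morphisms.CechModule
import Mathlib.CategoryTheory.Preadditive.Biproducts
import HarnessLib

/-!
# Functoriality of the internal Hom `𝓗om_{𝒪_X}(E, N)` in the first variable; `Ȟ¹` and biproducts

Continuation of `Modules/SheafHom.lean` and `Modules/SheafHomFunctor.lean` (the `𝒪_X`-module
`𝓗om(E, N)`, `U ↦ Hom(E|_U, N|_U)`, Hartshorne II Ex. 1.15 / II.5 p. 109; The Stacks project,
Tag 01CM), which treat the covariant functoriality `N ↦ 𝓗om(E, N)`. Here: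

* `sheafHomMapLeft φ N : 𝓗om(E₂, N) ⟶ 𝓗om(E₁, N)` for `φ : E₁ ⟶ E₂` — pre-composition with the
  restriction `φ|_U` on sections over `U`; it is contravariantly functorial (`sheafHomMapLeft_id`,
  `sheafHomMapLeft_comp`), additive (`sheafHomMapLeft_add`, `sheafHomMapLeft_zero`) and commutes
  with the covariant functoriality (`sheafHomMapLeft_sheafHomMap`); `sheafHomMapLeftIso` — an
  isomorphism `E₁ ≅ E₂` induces `𝓗om(E₁, N) ≅ 𝓗om(E₂, N)`; `isZero_sheafHom_of_isZero`.
* Consequences for the first Čech cohomology `Ȟ¹(𝒰, –)` of `Morphisms/CechModule.lean`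
  (`CechMH1 f M U`, functorial through `cechMapH1`): `cechMapH1` is additive and unital
  (`cechMapH1_add_apply`, `cechMapH1_id_apply`), `Ȟ¹` of a zero module vanishes, `Ȟ¹` vanishing is
  invariant under isomorphism, and — the target of this file —
  **`subsingleton_cechMH1_sheafHom_biprod`**: if `Ȟ¹(𝒰, 𝓗om(E, N)) = 0` and
  `Ȟ¹(𝒰, 𝓗om(E', N)) = 0` then `Ȟ¹(𝒰, 𝓗om(E ⊞ E', N)) = 0`. The proof only uses the biproduct
  identity `fst ≫ inl + snd ≫ inr = 𝟙` in the abelian category `X.Modules` transported through the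
  additive contravariant functor `𝓗om(–, N)` and the additive functor `Ȟ¹(𝒰, –)`: a class `x` equals
  `Ȟ¹(𝓗om(fst, N))(Ȟ¹(𝓗om(inl, N)) x) + Ȟ¹(𝓗om(snd, N))(Ȟ¹(𝓗om(inr, N)) x)` and both inner classes
  live in trivial groups (no identification `𝓗om(E ⊞ E', N) ≅ 𝓗om(E, N) ⊞ 𝓗om(E', N)` is needed).

Everything is proved; no named facts. Mathlib (this pin) has no internal Hom of sheaves of modules
(see the design notes of `Modules/SheafHom.lean`), hence nothing to reuse for the first item; for
the second, `CechMH1` is the tree's own construction.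

## References

* R. Hartshorne, *Algebraic Geometry*, GTM 52 (1977): II Ex. 1.15 (p. 67), II.5 (p. 109).
  [Hartshorne1977]
* The Stacks project, Tag 01CM (Modules: internal Hom), Tag 01ED (Cohomology, Section 20.9: the
  Čech complex is functorial in the sheaf). [StacksProject]
-/

noncomputable section

open CategoryTheory AlgebraicGeometry Opposite TopologicalSpace Limits

namespace Literature.AlgebraicGeometry.Modules

universe u v

variable {X : Scheme.{u}}

/-! ### Functoriality of `𝓗om(E, N)` in `E` -/

section MapLeft

variable {E₁ E₂ E₃ : X.Modules} (N : X.Modules) {U W : X.Opens}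

/-- **Pre-composition with `φ : E₁ → E₂`**: the morphism `𝓗om(E₂, N) → 𝓗om(E₁, N)`,
`ψ ↦ φ|_U ≫ ψ` on sections over `U` (the internal Hom is a functor in both variables,
contravariant in the first). [cite: StacksProject, Tag 01CM] -/
def sheafHomMapLeft (φ : E₁ ⟶ E₂) (N : X.Modules) : sheafHom E₂ N ⟶ sheafHom E₁ N where
  val := PresheafOfModules.homMk
    { app := fun U => AddCommGrpCat.ofHom
        { toFun := fun ψ : E₂.over U.unop ⟶ N.over U.unop =>
            (SheafOfModules.overFunctor _ U.unop).map φ ≫ ψ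
          map_zero' := comp_zero
          map_add' := fun ψ ψ' => Preadditive.comp_add _ _ _ _ ψ ψ' }
      naturality := fun {U V} i => by
        refine AddCommGrpCat.ext fun (ψ : E₂.over U.unop ⟶ N.over U.unop) => ?_
        change (SheafOfModules.overFunctor _ V.unop).map φ ≫ restrictHom i.unop ψ =
          restrictHom i.unop ((SheafOfModules.overFunctor _ U.unop).map φ ≫ ψ)
        rw [restrictHom_comp, restrictHom_over_map] }
    (fun U (a : Γ(X, U.unop)) (ψ : E₂.over U.unop ⟶ N.over U.unop) => by
      change (SheafOfModules.overFunctor _ U.unop).map φ ≫ (a • ψ) =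
        a • ((SheafOfModules.overFunctor _ U.unop).map φ ≫ ψ)
      rw [smul_overHom_def, smul_overHom_def, Category.assoc])

/-- Sections of `sheafHomMapLeft φ N`: `ψ ↦ φ|_U ≫ ψ`. [folklore] -/
@[simp]
lemma sheafHomMapLeft_app_apply (φ : E₁ ⟶ E₂) (U : X.Opens) (ψ : E₂.over U ⟶ N.over U) :
    (sheafHomMapLeft φ N).app U ψ = (SheafOfModules.overFunctor _ U).map φ ≫ ψ := rfl

/-- Values of `φ|_U ≫ ψ`: apply `φ`, then `ψ`. [folklore] -/
lemma appLE_over_map_comp (φ : E₁ ⟶ E₂) (ψ : E₂.over U ⟶ N.over U) (k : W ⟶ U)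
    (s : Γ(E₁, W)) :
    appLE ((SheafOfModules.overFunctor _ U).map φ ≫ ψ) k s = appLE ψ k (φ.app W s) := rfl

/-- `𝓗om(𝟙, N) = 𝟙`. [folklore] -/
@[simp]
lemma sheafHomMapLeft_id (E : X.Modules) : sheafHomMapLeft (𝟙 E) N = 𝟙 (sheafHom E N) := by
  refine Scheme.Modules.hom_ext _ _ fun U => AddCommGrpCat.ext fun (ψ : E.over U ⟶ N.over U) =>
    hom_ext_of_appLE fun W k s => ?_
  change appLE ((SheafOfModules.overFunctor _ U).map (𝟙 E) ≫ ψ) k s = appLE ψ k s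
  rw [appLE_over_map_comp]
  rfl

/-- `𝓗om(φ ≫ φ', N) = 𝓗om(φ', N) ≫ 𝓗om(φ, N)` (contravariance). [folklore] -/
lemma sheafHomMapLeft_comp (φ : E₁ ⟶ E₂) (φ' : E₂ ⟶ E₃) :
    sheafHomMapLeft (φ ≫ φ') N = sheafHomMapLeft φ' N ≫ sheafHomMapLeft φ N := by
  refine Scheme.Modules.hom_ext _ _ fun U => AddCommGrpCat.ext fun (ψ : E₃.over U ⟶ N.over U) =>
    hom_ext_of_appLE fun W k s => ?_
  change appLE ((SheafOfModules.overFunctor _ U).map (φ ≫ φ') ≫ ψ) k s =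
    appLE ((SheafOfModules.overFunctor _ U).map φ ≫
      ((SheafOfModules.overFunctor _ U).map φ' ≫ ψ)) k s
  rw [appLE_over_map_comp, appLE_over_map_comp, appLE_over_map_comp]
  rfl

/-- `𝓗om(φ + φ', N) = 𝓗om(φ, N) + 𝓗om(φ', N)`. [folklore] -/
lemma sheafHomMapLeft_add (φ φ' : E₁ ⟶ E₂) :
    sheafHomMapLeft (φ + φ') N = sheafHomMapLeft φ N + sheafHomMapLeft φ' N := by
  refine Scheme.Modules.hom_ext _ _ fun U => AddCommGrpCat.ext fun (ψ : E₂.over U ⟶ N.over U) =>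
    hom_ext_of_appLE fun W k s => ?_
  change appLE ((SheafOfModules.overFunctor _ U).map (φ + φ') ≫ ψ) k s =
    appLE (((SheafOfModules.overFunctor _ U).map φ ≫ ψ) +
      ((SheafOfModules.overFunctor _ U).map φ' ≫ ψ)) k s
  rw [appLE_add, appLE_over_map_comp, appLE_over_map_comp, appLE_over_map_comp,
    ← appLE_add_right]
  rfl

/-- `𝓗om(0, N) = 0`. [folklore] -/
@[simp]
lemma sheafHomMapLeft_zero : sheafHomMapLeft (0 : E₁ ⟶ E₂) N = 0 := by
  refine Scheme.Modules.hom_ext _ _ fun U => AddCommGrpCat.ext fun (ψ : E₂.over U ⟶ N.over U) =>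
    hom_ext_of_appLE fun W k s => ?_
  change appLE ((SheafOfModules.overFunctor _ U).map (0 : E₁ ⟶ E₂) ≫ ψ) k s =
    appLE (0 : E₁.over U ⟶ N.over U) k s
  rw [appLE_over_map_comp, appLE_zero, ← appLE_zero_right ψ k]
  rfl

/-- `𝓗om(φ - φ', N) = 𝓗om(φ, N) - 𝓗om(φ', N)`. [folklore] -/
lemma sheafHomMapLeft_sub (φ φ' : E₁ ⟶ E₂) :
    sheafHomMapLeft (φ - φ') N = sheafHomMapLeft φ N - sheafHomMapLeft φ' N := by
  rw [eq_sub_iff_add_eq, ← sheafHomMapLeft_add, sub_add_cancel]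

/-- `𝓗om(-φ, N) = -𝓗om(φ, N)`. [folklore] -/
lemma sheafHomMapLeft_neg (φ : E₁ ⟶ E₂) : sheafHomMapLeft (-φ) N = -sheafHomMapLeft φ N := by
  rw [neg_eq_zero_sub, sheafHomMapLeft_sub, sheafHomMapLeft_zero, zero_sub]

/-- **Bifunctoriality**: pre-composition with `φ : E₁ → E₂` commutes with post-composition with
`g : M → N`. [folklore] -/
@[reassoc]
lemma sheafHomMapLeft_sheafHomMap {M : X.Modules} (φ : E₁ ⟶ E₂) (g : M ⟶ N) :
    sheafHomMapLeft φ M ≫ sheafHomMap E₁ g = sheafHomMap E₂ g ≫ sheafHomMapLeft φ N := by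
  refine Scheme.Modules.hom_ext _ _ fun U => AddCommGrpCat.ext fun (ψ : E₂.over U ⟶ M.over U) => ?_
  change ((SheafOfModules.overFunctor _ U).map φ ≫ ψ) ≫ (SheafOfModules.overFunctor _ U).map g =
    (SheafOfModules.overFunctor _ U).map φ ≫ (ψ ≫ (SheafOfModules.overFunctor _ U).map g)
  rw [Category.assoc]

/-- An isomorphism `e : E₁ ≅ E₂` induces an isomorphism `𝓗om(E₁, N) ≅ 𝓗om(E₂, N)`
(pre-composition with `e⁻¹`, inverse pre-composition with `e`). [folklore] -/
def sheafHomMapLeftIso (e : E₁ ≅ E₂) (N : X.Modules) : sheafHom E₁ N ≅ sheafHom E₂ N where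
  hom := sheafHomMapLeft e.inv N
  inv := sheafHomMapLeft e.hom N
  hom_inv_id := by rw [← sheafHomMapLeft_comp, e.hom_inv_id, sheafHomMapLeft_id]
  inv_hom_id := by rw [← sheafHomMapLeft_comp, e.inv_hom_id, sheafHomMapLeft_id]

/-- The forward map of `sheafHomMapLeftIso e N` is `𝓗om(e⁻¹, N)`. [folklore] -/
@[simp]
lemma sheafHomMapLeftIso_hom (e : E₁ ≅ E₂) :
    (sheafHomMapLeftIso e N).hom = sheafHomMapLeft e.inv N :=
  rfl

/-- The inverse map of `sheafHomMapLeftIso e N` is `𝓗om(e, N)`. [folklore] -/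
@[simp]
lemma sheafHomMapLeftIso_inv (e : E₁ ≅ E₂) :
    (sheafHomMapLeftIso e N).inv = sheafHomMapLeft e.hom N :=
  rfl

/-- `𝓗om(E, N)` of a zero module `E` is a zero module. [folklore] -/
lemma isZero_sheafHom_of_isZero {E : X.Modules} (hE : IsZero E) (N : X.Modules) :
    IsZero (sheafHom E N) := by
  rw [IsZero.iff_id_eq_zero, ← sheafHomMapLeft_id, hE.eq_of_src (𝟙 E) 0, sheafHomMapLeft_zero]

end MapLeft

/-! ### `Ȟ¹(𝒰, –)`: additivity, zero modules, isomorphisms, and `𝓗om` out of a biproduct -/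

section Cech

open Literature.AlgebraicGeometry.Morphisms

variable {A : Type u} [CommRing A] (f : X ⟶ Spec (.of A)) {ι : Type v} (U : ι → X.Opens)

/-- `Ȟ¹(𝒰, 𝟙_M) = id`. [folklore] -/
@[simp]
theorem cechMapH1_id_apply {M : X.Modules} (x : CechMH1 f M U) : cechMapH1 f (𝟙 M) U x = x := by
  obtain ⟨z, rfl⟩ := CechMH1.mk_surjective f M U x
  rw [cechMapH1_mk]
  congr 1

/-- **`Ȟ¹(𝒰, –)` is additive**: `Ȟ¹(φ + ψ) = Ȟ¹(φ) + Ȟ¹(ψ)` (the Čech complex is an additive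
functor of the sheaf). [cite: StacksProject, Tag 01ED (Cohomology, Section 20.9)] -/
theorem cechMapH1_add_apply {M N : X.Modules} (φ ψ : M ⟶ N) (x : CechMH1 f M U) :
    cechMapH1 f (φ + ψ) U x = cechMapH1 f φ U x + cechMapH1 f ψ U x := by
  obtain ⟨z, rfl⟩ := CechMH1.mk_surjective f M U x
  rw [cechMapH1_mk, cechMapH1_mk, cechMapH1_mk, ← map_add]
  congr 1

/-- `Ȟ¹(𝒰, M) = 0` for a zero module `M`. [folklore] -/
theorem subsingleton_cechMH1_of_isZero {M : X.Modules} (hM : IsZero M) :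
    Subsingleton (CechMH1 f M U) := by
  refine subsingleton_of_forall_eq 0 fun x => ?_
  rw [← cechMapH1_id_apply f U x, hM.eq_of_src (𝟙 M) 0, cechMapH1_zero]

/-- `Ȟ¹(𝒰, e)` is injective for an isomorphism `e`. [folklore] -/
theorem cechMapH1_injective_of_iso {M N : X.Modules} (e : M ≅ N) :
    Function.Injective (cechMapH1 f e.hom U) := by
  intro x y hxy
  have h := congrArg (cechMapH1 f e.inv U) hxy
  rwa [← cechMapH1_comp, ← cechMapH1_comp, e.hom_inv_id, cechMapH1_id_apply,
    cechMapH1_id_apply] at h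

/-- `Ȟ¹` vanishing is invariant under isomorphism: if `M ≅ N` and `Ȟ¹(𝒰, N) = 0` then
`Ȟ¹(𝒰, M) = 0`. [folklore] -/
theorem subsingleton_cechMH1_of_iso {M N : X.Modules} (e : M ≅ N)
    (h : Subsingleton (CechMH1 f N U)) : Subsingleton (CechMH1 f M U) :=
  (cechMapH1_injective_of_iso f U e).subsingleton

/-- `Ȟ¹(𝒰, 𝓗om(–, N))` vanishing is invariant under isomorphism of the first variable.
[folklore] -/
theorem subsingleton_cechMH1_sheafHom_of_iso {E₁ E₂ : X.Modules} (e : E₁ ≅ E₂) (N : X.Modules)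
    (h : Subsingleton (CechMH1 f (sheafHom E₁ N) U)) :
    Subsingleton (CechMH1 f (sheafHom E₂ N) U) :=
  subsingleton_cechMH1_of_iso f U (sheafHomMapLeftIso e N).symm h

/-- `Ȟ¹(𝒰, 𝓗om(E, N)) = 0` for a zero module `E`. [folklore] -/
theorem subsingleton_cechMH1_sheafHom_of_isZero {E : X.Modules} (hE : IsZero E) (N : X.Modules) :
    Subsingleton (CechMH1 f (sheafHom E N) U) :=
  subsingleton_cechMH1_of_isZero f U (isZero_sheafHom_of_isZero hE N)

/-- The biproduct identity transported through `𝓗om(–, N)`: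
`𝓗om(inl, N) ≫ 𝓗om(fst, N) + 𝓗om(inr, N) ≫ 𝓗om(snd, N) = 𝟙_{𝓗om(E ⊞ E', N)}`. [folklore] -/
lemma sheafHomMapLeft_biprod_total (E E' N : X.Modules) :
    sheafHomMapLeft (biprod.inl : E ⟶ E ⊞ E') N ≫ sheafHomMapLeft biprod.fst N +
      sheafHomMapLeft (biprod.inr : E' ⟶ E ⊞ E') N ≫ sheafHomMapLeft biprod.snd N = 𝟙 _ := by
  rw [← sheafHomMapLeft_comp, ← sheafHomMapLeft_comp, ← sheafHomMapLeft_add, biprod.total,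
    sheafHomMapLeft_id]

/-- **`Ȟ¹` vanishing for `𝓗om` out of a biproduct.** If `Ȟ¹(𝒰, 𝓗om(E, N)) = 0` and
`Ȟ¹(𝒰, 𝓗om(E', N)) = 0` then `Ȟ¹(𝒰, 𝓗om(E ⊞ E', N)) = 0`: every class `x` equals
`Ȟ¹(𝓗om(fst, N))(Ȟ¹(𝓗om(inl, N)) x) + Ȟ¹(𝓗om(snd, N))(Ȟ¹(𝓗om(inr, N)) x)` by
`sheafHomMapLeft_biprod_total`, and the inner classes vanish. [folklore] -/
theorem subsingleton_cechMH1_sheafHom_biprod (E E' N : X.Modules)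
    (h : Subsingleton (CechMH1 f (sheafHom E N) U))
    (h' : Subsingleton (CechMH1 f (sheafHom E' N) U)) :
    Subsingleton (CechMH1 f (sheafHom (E ⊞ E') N) U) := by
  refine subsingleton_of_forall_eq 0 fun x => ?_
  have h₁ : cechMapH1 f (sheafHomMapLeft (biprod.inl : E ⟶ E ⊞ E') N) U x = 0 :=
    Subsingleton.elim _ _
  have h₂ : cechMapH1 f (sheafHomMapLeft (biprod.inr : E' ⟶ E ⊞ E') N) U x = 0 :=
    Subsingleton.elim _ _
  rw [← cechMapH1_id_apply f U x, ← sheafHomMapLeft_biprod_total, cechMapH1_add_apply,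
    cechMapH1_comp, cechMapH1_comp, h₁, h₂, map_zero, map_zero, add_zero]

end Cech

end Literature.AlgebraicGeometry.Modules

end
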